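import Mathlib
import HarnessLib
import Summits.HubbardSuperconductivity.HubbardSuperconductivity.Theorems.KLProgrammeKLRegimeEngineTowerReadout
import Summits.HubbardSuperconductivity.HubbardSuperconductivity.Theorems.KLProgrammeKLRegimeEngineTowerLevFloorReadoutUnits

/-!
# Route `KLProgramme` — crux K3 ENGINE (stmt-HubbardSuperconductivity-20437 `KLRegimeEngineV17F2`), stub (b) v2, THE LEVELS PACKAGE (ℓ), located item
# «(ℓ)-READOUT-F» piece (RO-4, generic half): THE READ-OUT FIT — a public size dominated by a RE-MEASURED part under its own profile plus a
# PARTIAL-BLOCK INCREMENT under the kit step is below ONE law `A_tot·λ^{p−1}·Q_tot^p`, and that law times the floor unit is `KernelNormsLevels`' right-hand side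
# (cell gate-hubbard-kl, seat hubbard-kl-k3c3-p2 g16; E1 part 7 `towerReadoutIncrement_le` ∘ k3c3-p2 g14 `law_mul_klLevUnitF_le_levelsRHS`)

WHY.  At a read-out level `j ∈ [dk, d(k+1))` the action splits as `𝒱_j = 𝒱_{dk} + (𝒱_j − 𝒱_{dk})`; the levelled size of `𝒱_j` at `F_j` in floor units is at
most `ro + inc` with `ro ≤ A_ro·λ^{p−1}·Q_ro^p` (the re-measured input, …TowerLevReadoutProfileF `readoutLevF_le_profileR`: the law's input profile verbatim)
and `inc` obeying the kit step read on the block's measured array (k3c2-p3's RO-2).  E1's part 7 `towerReadout_le` asks `pub ≤ μ p + inc` with ONE array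
`μ` serving both as the re-measured size and as the kit's Chernoff datum; in the floor keying these live in different units (the kit reads the SCALED array
`W·Z^m·klTowerMuLevF`, the read-out is unscaled), so this file states the fit with the re-measured part as a SEPARATE bound:

* §1 **`towerReadout_le_of_ro`** — `pub ≤ ro + inc`, `ro ≤ A_ro λ^{p−1} Q_ro^p`, `inc` under the kit step with Chernoff data `(A″, Q″, ι₁, ι₂, ι₃)` and the five
  smallness rows ⇒ `pub ≤ λ^{p−1}·(A_ro Q_ro^p + A″(4Q″)^p·x₁/(1−x₁) + e·ψ·(2τψQ″)^{p−1}·τY·y/(1−y))` (`towerReadoutIncrement_le` + add);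
* §2 **`readoutBracket_le_law`** — that bracket is `≤ A_tot·Q_tot^p` with `Q_tot = max 1 (max Q_ro (max (4Q″) (2τψQ″)))`,
  `A_tot = A_ro + A″·x₁/(1−x₁) + e·ψ·τY·y/(1−y)` (pure real algebra, `p ≥ 1`);
* §3 **`readoutLev_le_levelsRHS`** — if `X / klLevUnitF β M t p J ≤ A_tot·(B·ε_J)^{p−1}·Q_tot^p` and `CE ≥ (Q_tot·ε_x²)·B·max 1 (A_tot/ε_x)` then
  `X ≤ CE^p·ε_J^{p−1}·2^{(3p−5)J}·((2^J)⁻¹)^{levelGainExp (t+1)}` — the registered `KernelNormsLevels` right-hand side at level `J`, level count `t + 1`.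
Pure real analysis; nothing about the model is asserted; nothing asserts (ℓ), any stub, K3 or superconductivity.
References: BGM 2006 §2.8 (2.93)–(2.98), Lemma 2.5 (2.98) [cite: BenfattoGiulianiMastropietro2006].
-/

noncomputable section

namespace Summit.HubbardSuperconductivity.HubbardSuperconductivity.Theorems.EngineV8

set_option linter.dupNamespace false -- summit = problem name (single-conjunct summit), D-0017

open Real Finset Literature.MathematicalPhysics.QuantumLattice
open Summit.HubbardSuperconductivity.HubbardSuperconductivity.Theorems.KLRegimeSplit
open Summit.HubbardSuperconductivity.HubbardSuperconductivity.Theorems.DispersionFlow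

/-! ## §1 The read-out with the re-measured part under its own profile -/

/-- **THE READ-OUT FIT WITH A SEPARATE RE-MEASURED PROFILE**: `pub ≤ ro + inc`, `ro ≤ A_ro·λ^{p−1}·Q_ro^p`, and `inc` under the kit step on a
Chernoff array `μ` with data `(A″, Q″, ι₁, ι₂, ι₃)` and the five smallness rows (as `towerReadoutIncrement_le`) ⇒
`pub ≤ λ^{p−1}·(A_ro·Q_ro^p + A″(4Q″)^p·x₁/(1−x₁) + e·ψ·(2τψQ″)^{p−1}·τY·y/(1−y))`, `x₁ = 4σλQ″`, `Y = ι₁λ + ι₂/(2Q″) + ι₃/(4Q″²) + A″Q″/4`, `y = ΦτY`.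
[cite: BenfattoGiulianiMastropietro2006, §2.8 (2.93)-(2.98)] -/
theorem towerReadout_le_of_ro {D : ℕ} {μ : ℕ → ℝ} {pub ro inc σ Φ ψ τ lam A'' Q'' ι₁ ι₂ ι₃ Aro Qro : ℝ}
    (hσ : 0 ≤ σ) (hΦ : 0 ≤ Φ) (hψ : 0 ≤ ψ) (hτ : 0 < τ) (hlam : 0 < lam) (hA'' : 0 ≤ A'') (hQ'' : 0 < Q'')
    (hμ0 : ∀ m, 0 ≤ μ m) (hι₁ : μ 1 ≤ ι₁ * lam) (hι₂ : μ 2 ≤ ι₂ * lam) (hι₃ : μ 3 ≤ ι₃ * lam ^ 2)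
    (hprof : ∀ m, 4 ≤ m → m ≤ D → μ m ≤ A'' * lam ^ (m - 1) * Q'' ^ m)
    (hx₁ : 4 * σ * lam * Q'' < 1) (hx₂ : 2 * lam * τ * Q'' ≤ 1) (hx₃ : exp 1 * τ * lam * Q'' < 1)
    (hy : Φ * (τ * (ι₁ * lam + ι₂ / (2 * Q'') + ι₃ / (4 * Q'' ^ 2) + A'' * Q'' / 4)) < 1)
    (hθ : Φ * (exp 1 * τ * (ι₁ * lam) + (exp 1 * τ) ^ 2 * (ι₂ * lam) + (exp 1 * τ) ^ 3 * (ι₃ * lam ^ 2) +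
      A'' * (exp 1 * τ * Q'') * ((exp 1 * τ * lam * Q'') ^ 3 / (1 - exp 1 * τ * lam * Q''))) < 1)
    {p : ℕ} (hp : 3 ≤ p) (hpub : pub ≤ ro + inc) (hro : ro ≤ Aro * lam ^ (p - 1) * Qro ^ p)
    (hstep : ∀ N : ℕ, 2 ≤ N → Φ * towerV D τ μ < 1 →
      inc ≤ towerFO D σ μ p + ∑ n ∈ Icc 2 N, exp 1 * Φ ^ (n - 1) * ψ ^ p * towerS D τ μ n p +
        ψ ^ p * exp 1 * towerV D τ μ * (Φ * towerV D τ μ) ^ N / (1 - Φ * towerV D τ μ)) :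
    pub ≤ lam ^ (p - 1) * (Aro * Qro ^ p + A'' * (4 * Q'') ^ p * (4 * σ * lam * Q'' / (1 - 4 * σ * lam * Q'')) +
      exp 1 * ψ * (2 * τ * ψ * Q'') ^ (p - 1) * (τ * (ι₁ * lam + ι₂ / (2 * Q'') + ι₃ / (4 * Q'' ^ 2) + A'' * Q'' / 4)) *
        (Φ * (τ * (ι₁ * lam + ι₂ / (2 * Q'') + ι₃ / (4 * Q'' ^ 2) + A'' * Q'' / 4)) /
          (1 - Φ * (τ * (ι₁ * lam + ι₂ / (2 * Q'') + ι₃ / (4 * Q'' ^ 2) + A'' * Q'' / 4))))) := by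
  have hinc := towerReadoutIncrement_le (D := D) hσ hΦ hψ hτ hlam hA'' hQ'' hμ0 hι₁ hι₂ hι₃ hprof hx₁ hx₂ hx₃ hy hθ hp hstep
  have hro' : ro ≤ lam ^ (p - 1) * (Aro * Qro ^ p) := by rw [← mul_assoc, mul_comm (lam ^ (p - 1))]; exact hro
  refine hpub.trans ((add_le_add hro' hinc).trans (le_of_eq ?_))
  ring

/-! ## §2 The bracket under one law -/

/-- **The read-out bracket is geometric in `p`**: with `Q_tot = max 1 (max Q_ro (max (4Q″) (2τψQ″)))` and
`A_tot = A_ro + A″·X₁ + e·ψ·(τY)·Yy` (`X₁, Yy ≥ 0` the two geometric factors), for every `p`: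
`A_ro·Q_ro^p + A″(4Q″)^p·X₁ + e·ψ·(2τψQ″)^{p−1}·(τY)·Yy ≤ A_tot·Q_tot^p` (`A_ro, Q_ro, A″, Q″, ψ, τY ≥ 0`). [folklore] -/
theorem readoutBracket_le_law {Aro Qro A'' Q'' ψ τ X₁ TY Yy : ℝ} (hAro : 0 ≤ Aro) (hQro : 0 ≤ Qro) (hA'' : 0 ≤ A'') (hQ'' : 0 ≤ Q'')
    (hψ : 0 ≤ ψ) (hτ : 0 ≤ τ) (hX₁ : 0 ≤ X₁) (hTY : 0 ≤ TY) (hYy : 0 ≤ Yy) (p : ℕ) :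
    Aro * Qro ^ p + A'' * (4 * Q'') ^ p * X₁ + exp 1 * ψ * (2 * τ * ψ * Q'') ^ (p - 1) * TY * Yy ≤
      (Aro + A'' * X₁ + exp 1 * ψ * TY * Yy) * (max 1 (max Qro (max (4 * Q'') (2 * τ * ψ * Q'')))) ^ p := by
  set Qt : ℝ := max 1 (max Qro (max (4 * Q'') (2 * τ * ψ * Q''))) with hQt
  have hQt1 : 1 ≤ Qt := le_max_left _ _
  have hQt0 : 0 ≤ Qt := zero_le_one.trans hQt1
  have h1 : Qro ≤ Qt := (le_max_left _ _).trans (le_max_right _ _)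
  have h2 : 4 * Q'' ≤ Qt := ((le_max_left _ _).trans (le_max_right _ _)).trans (le_max_right _ _)
  have h3 : 2 * τ * ψ * Q'' ≤ Qt := ((le_max_right _ _).trans (le_max_right _ _)).trans (le_max_right _ _)
  have hp1 : Qro ^ p ≤ Qt ^ p := pow_le_pow_left₀ hQro h1 p
  have hp2 : (4 * Q'') ^ p ≤ Qt ^ p := pow_le_pow_left₀ (by positivity) h2 p
  have hp3 : (2 * τ * ψ * Q'') ^ (p - 1) ≤ Qt ^ p :=
    (pow_le_pow_left₀ (by positivity) h3 (p - 1)).trans (pow_le_pow_right₀ hQt1 (Nat.sub_le p 1))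
  have he : 0 ≤ exp 1 * ψ := by positivity
  calc Aro * Qro ^ p + A'' * (4 * Q'') ^ p * X₁ + exp 1 * ψ * (2 * τ * ψ * Q'') ^ (p - 1) * TY * Yy
      ≤ Aro * Qt ^ p + A'' * Qt ^ p * X₁ + exp 1 * ψ * Qt ^ p * TY * Yy := by
        refine add_le_add (add_le_add (mul_le_mul_of_nonneg_left hp1 hAro) ?_) ?_
        · exact mul_le_mul_of_nonneg_right (mul_le_mul_of_nonneg_left hp2 hA'') hX₁
        · exact mul_le_mul_of_nonneg_right (mul_le_mul_of_nonneg_right (mul_le_mul_of_nonneg_left hp3 he) hTY) hYy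
    _ = (Aro + A'' * X₁ + exp 1 * ψ * TY * Yy) * Qt ^ p := by ring

/-! ## §3 The levels right-hand side -/

/-- **THE READ-OUT SIZE IS BELOW `KernelNormsLevels`' RIGHT-HAND SIDE**: if a nonnegative size `X`, read in the floor unit of track `t`, degree `2p`, family
`J`, obeys `X / klLevUnitF β M t p J ≤ A_tot·(B·ε_J)^{p−1}·Q_tot^p` (`A_tot, Q_tot ≥ 0`, `B ≥ 1`, `p ≥ 1`) and the threshold
`CE ≥ (Q_tot·ε_x²)·B·max 1 (A_tot/ε_x)` holds, then `X ≤ CE^p·ε_J^{p−1}·2^{(3p−5)J}·((2^J)⁻¹)^{levelGainExp (t+1)}`.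
[cite: BenfattoGiulianiMastropietro2006, Lemma 2.5 (2.98)] -/
theorem readoutLev_le_levelsRHS {β : ℝ} (hβ : 0 < β) {M : ℕ} [NeZero M] {P : SplitConsts} (hK : 0 ≤ P.Klam) (U : ℝ)
    {Atot Qtot B CE X : ℝ} (hA : 0 ≤ Atot) (hQ : 0 ≤ Qtot) (hB : 1 ≤ B)
    (hCE : Qtot * imagTimeWeight β M ^ 2 * B * max 1 (Atot / imagTimeWeight β M) ≤ CE)
    (t : Fin 5) {p : ℕ} (hp : 1 ≤ p) (J : ℕ)
    (hX : X / klLevUnitF β M t p J ≤ Atot * (B * epsCoupling P U J) ^ (p - 1) * Qtot ^ p) :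
    X ≤ CE ^ p * epsCoupling P U J ^ (p - 1) * (2 : ℝ) ^ ((3 * (p : ℤ) - 5) * J) * (((2 : ℝ) ^ J)⁻¹) ^ levelGainExp ((t : ℕ) + 1) := by
  have hu : 0 < klLevUnitF β M t p J := klLevUnitF_pos hβ t p J
  have h1 : X ≤ Atot * (B * epsCoupling P U J) ^ (p - 1) * Qtot ^ p * klLevUnitF β M t p J := (div_le_iff₀ hu).1 hX
  exact h1.trans (law_mul_klLevUnitF_le_levelsRHS hβ hK U hA hQ hB hCE t hp J)

end Summit.HubbardSuperconductivity.HubbardSuperconductivity.Theorems.EngineV8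

end
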